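import Mathlib

/-!
# Tier4/Line4/UltrametricCoords — the ultrametric coordinate lemma behind P2 (the `q`-adic congruence at `γ₀`)

Blind re-derivation cell `pub-hodge-repro`, Tier 4 «prove the step» (README §9–§10), seat t4-L2-p3 (gen 5; plan-4 g5's
ruling S15514, statement S15538).  Tree path `lean/Summits/Ventures/HodgeRepro/Tier4/Line4/UltrametricCoords.lean`.
Mathlib only, over an arbitrary field `K` with a valuation `vv : Valuation K Γ₀` into a linearly ordered commutative
group with zero:

* `valuation_mul_apply_le`, `valuation_mulVec_apply_le`, `valuation_add_apply_le`: entrywise ultrametric bounds of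
  matrix products, matrix–vector products and sums;
* `valuation_sub_one_eq_of_one_lt`: `vv (a − 1) = vv a` for `vv a > 1`;
* **`coords_near_one`** (THE COORDINATE LEMMA): if `ξ_Y = a ξ_X + b Ω ξ_X` with `ξ_X`, `ξ_Y` within `δ` of a vector
  `ξ_Γ` on which the `2 × 4` matrix `R` reads the coordinates (`R ξ_Γ = e₀`, `R Ω ξ_Γ = e₁`), `R`, `Ω` entrywise
  `≤ M`, `1 ≤ M`, `M² δ < 1`, then `vv (a − 1) ≤ M² δ` and `vv b ≤ M² δ` — the ultrametric inequality forces
  `max (vv a) (vv b) ≤ 1` first, then the two coordinate identities give the bounds.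

No printed input is consumed.  HC_CM is NOT proved by anyone in this repository.
-/

set_option autoImplicit false
noncomputable section
namespace Summit.Ventures.HodgeRepro.Tier4.Line4
open Matrix

section Ultrametric
variable {K Γ₀ : Type} [Field K] [LinearOrderedCommGroupWithZero Γ₀] (vv : Valuation K Γ₀)

/-- entrywise bound of a matrix product (ultrametric). -/
theorem valuation_mul_apply_le {m n p : Type} [Fintype n] {A : Matrix m n K} {B : Matrix n p K} {ε ε' : Γ₀}
    (hA : ∀ a b, vv (A a b) ≤ ε) (hB : ∀ a b, vv (B a b) ≤ ε') (a : m) (c : p) : vv ((A * B) a c) ≤ ε * ε' := by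
  rw [Matrix.mul_apply]
  refine Valuation.map_sum_le vv fun b _ => ?_
  rw [map_mul]
  exact mul_le_mul' (hA a b) (hB b c)

/-- entrywise bound of a matrix-vector product (ultrametric). -/
theorem valuation_mulVec_apply_le {m n : Type} [Fintype n] {A : Matrix m n K} {x : n → K} {ε ε' : Γ₀}
    (hA : ∀ a b, vv (A a b) ≤ ε) (hx : ∀ b, vv (x b) ≤ ε') (a : m) : vv ((A *ᵥ x) a) ≤ ε * ε' := by
  rw [Matrix.mulVec, dotProduct]
  refine Valuation.map_sum_le vv fun b _ => ?_
  rw [map_mul]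
  exact mul_le_mul' (hA a b) (hx b)

/-- entrywise bound of a sum. -/
theorem valuation_add_apply_le {m n : Type} {A B : Matrix m n K} {ε : Γ₀}
    (hA : ∀ a b, vv (A a b) ≤ ε) (hB : ∀ a b, vv (B a b) ≤ ε) (a : m) (b : n) : vv ((A + B) a b) ≤ ε := by
  rw [Matrix.add_apply]
  exact (vv.map_add _ _).trans (max_le (hA a b) (hB a b))

/-- `vv (a - 1) = vv a` when `vv a > 1` (ultrametric). -/
theorem valuation_sub_one_eq_of_one_lt {a : K} (ha : 1 < vv a) : vv (a - 1) = vv a := by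
  have h1 : vv (-(1 : K)) < vv a := by rw [vv.map_neg, map_one]; exact ha
  rw [sub_eq_add_neg]
  exact Valuation.map_add_eq_of_lt_left vv h1

/-- **THE COORDINATE LEMMA**: if `ξ_Y = a ξ_X + b Ω ξ_X` with `ξ_X`, `ξ_Y` within `δ` of a vector `ξ_Γ` on which
the `2 × 4` matrix `R` reads the coordinates (`R ξ_Γ = e₀`, `R Ω ξ_Γ = e₁`), with `R`, `Ω` entrywise `≤ M`,
`1 ≤ M` and `M² δ < 1`, then `vv (a − 1) ≤ M² δ` and `vv b ≤ M² δ`. -/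
theorem coords_near_one (R : Matrix (Fin 2) (Fin 4) K) (Ω : Matrix (Fin 4) (Fin 4) K) (ξΓ ξX ξY : Fin 4 → K)
    (a b : K) (δ M : Γ₀) (hR0 : R *ᵥ ξΓ = Pi.single 0 1) (hR1 : R *ᵥ (Ω *ᵥ ξΓ) = Pi.single 1 1)
    (hY : ξY = a • ξX + b • (Ω *ᵥ ξX)) (hX : ∀ l, vv (ξX l - ξΓ l) ≤ δ) (hY' : ∀ l, vv (ξY l - ξΓ l) ≤ δ)
    (hRb : ∀ i l, vv (R i l) ≤ M) (hΩb : ∀ l m, vv (Ω l m) ≤ M) (hM : 1 ≤ M) (hsmall : M * M * δ < 1) :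
    vv (a - 1) ≤ M * M * δ ∧ vv b ≤ M * M * δ := by
  -- the error vectors
  set ε : Fin 4 → K := ξX - ξΓ with hε
  set ε' : Fin 4 → K := ξY - ξΓ with hε'
  have hεb : ∀ l, vv (ε l) ≤ δ := fun l => hX l
  have hε'b : ∀ l, vv (ε' l) ≤ δ := fun l => hY' l
  have hRε : ∀ i, vv ((R *ᵥ ε) i) ≤ M * δ := fun i => valuation_mulVec_apply_le vv hRb hεb i
  have hRε' : ∀ i, vv ((R *ᵥ ε') i) ≤ M * δ := fun i => valuation_mulVec_apply_le vv hRb hε'b i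
  have hRΩ : ∀ i l, vv ((R * Ω) i l) ≤ M * M := fun i l => valuation_mul_apply_le vv hRb hΩb i l
  have hRΩε : ∀ i, vv (((R * Ω) *ᵥ ε) i) ≤ M * M * δ := fun i => valuation_mulVec_apply_le vv hRΩ hεb i
  -- the two coordinate identities
  have hXeq : ξX = ξΓ + ε := by rw [hε]; abel
  have hYeq : ξY = ξΓ + ε' := by rw [hε']; abel
  have key : R *ᵥ ξY = a • (Pi.single 0 1 + R *ᵥ ε) + b • (Pi.single 1 1 + (R * Ω) *ᵥ ε) := by
    rw [hY, mulVec_add, mulVec_smul, mulVec_smul, hXeq, mulVec_add, hR0, mulVec_add, mulVec_add, hR1,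
      mulVec_mulVec]
  have key' : R *ᵥ ξY = Pi.single 0 1 + R *ᵥ ε' := by rw [hYeq, mulVec_add, hR0]
  have h0 := congrFun (key'.symm.trans key) 0
  have h1 := congrFun (key'.symm.trans key) 1
  simp only [Pi.add_apply, Pi.smul_apply, Pi.single_eq_same, Pi.single_eq_of_ne (show (1 : Fin 2) ≠ 0 by decide),
    Pi.single_eq_of_ne (show (0 : Fin 2) ≠ 1 by decide), smul_eq_mul] at h0 h1
  -- `a − 1 = (R ε′)₀ − a (R ε)₀ − b (R Ω ε)₀`, `b = (R ε′)₁ − a (R ε)₁ − b (R Ω ε)₁`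
  have ha1 : a - 1 = (R *ᵥ ε') 0 - a * (R *ᵥ ε) 0 - b * ((R * Ω) *ᵥ ε) 0 := by linear_combination -h0
  have hb1 : b = (R *ᵥ ε') 1 - a * (R *ᵥ ε) 1 - b * ((R * Ω) *ᵥ ε) 1 := by linear_combination -h1
  -- the bounds in terms of `m := max 1 (max (vv a) (vv b))`
  set m : Γ₀ := max 1 (max (vv a) (vv b)) with hm
  have hm1 : 1 ≤ m := le_max_left _ _
  have hma : vv a ≤ m := (le_max_left _ _).trans (le_max_right _ _)
  have hmb : vv b ≤ m := (le_max_right _ _).trans (le_max_right _ _)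
  have hMδ : M * δ ≤ M * M * δ := by
    calc M * δ = 1 * (M * δ) := (one_mul _).symm
      _ ≤ M * (M * δ) := by gcongr
      _ = M * M * δ := (mul_assoc _ _ _).symm
  have hbound : ∀ i, vv ((R *ᵥ ε') i - a * (R *ᵥ ε) i - b * ((R * Ω) *ᵥ ε) i) ≤ m * (M * M * δ) := by
    intro i
    refine (vv.map_sub _ _).trans (max_le ((vv.map_sub _ _).trans (max_le ?_ ?_)) ?_)
    · calc vv ((R *ᵥ ε') i) ≤ M * δ := hRε' i
        _ ≤ M * M * δ := hMδ
        _ = 1 * (M * M * δ) := (one_mul _).symm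
        _ ≤ m * (M * M * δ) := by gcongr
    · rw [map_mul]
      calc vv a * vv ((R *ᵥ ε) i) ≤ m * (M * δ) := mul_le_mul' hma (hRε i)
        _ ≤ m * (M * M * δ) := by gcongr
    · rw [map_mul]
      exact mul_le_mul' hmb (hRΩε i)
  have hA : vv (a - 1) ≤ m * (M * M * δ) := by rw [ha1]; exact hbound 0
  have hB : vv b ≤ m * (M * M * δ) := by rw [hb1]; exact hbound 1
  -- `m = 1`: otherwise the ultrametric inequality contradicts `M² δ < 1`
  have hm_eq : m = 1 := by
    by_contra hne
    have hgt : 1 < m := lt_of_le_of_ne hm1 (Ne.symm hne)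
    have hlt : m * (M * M * δ) < m := by
      calc m * (M * M * δ) < m * 1 := mul_lt_mul_of_pos_left hsmall (zero_lt_one.trans hgt)
        _ = m := mul_one m
    have hX1 : 1 ≤ max (vv a) (vv b) := by
      by_contra h
      exact hne (by rw [hm, max_eq_left (not_le.mp h).le])
    have hmax : max (vv a) (vv b) = m := by rw [hm, max_eq_right hX1]
    have hcase : vv a = m ∨ vv b = m := by
      rcases le_total (vv b) (vv a) with hab | hab
      · left; rw [← hmax, max_eq_left hab]
      · right; rw [← hmax, max_eq_right hab]
    rcases hcase with hca | hcb
    · have h1a : 1 < vv a := hca ▸ hgt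
      have := valuation_sub_one_eq_of_one_lt vv h1a
      rw [this, hca] at hA
      exact absurd (hA.trans_lt hlt) (lt_irrefl _)
    · rw [hcb] at hB
      exact absurd (hB.trans_lt hlt) (lt_irrefl _)
  rw [hm_eq, one_mul] at hA hB
  exact ⟨hA, hB⟩

end Ultrametric


end Summit.Ventures.HodgeRepro.Tier4.Line4
end
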